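import Literature.IUT.HodgeTheaters.TemperedCoveringsCor23iiiOfSpecialFibreHPrimeInputs
import Literature.IUT.HodgeTheaters.TemperedCoveringsCor23KerLevelOfAdmissibleKernel
import HarnessLib

/-!
# [IUTchI] Cor. 2.3 (iii) (and the (i)–(iv) / (i)–(v) blocks) AS TYPED at the genuine 𝔛-datum on the (H′) route with the
# input (y) from ONE LEVEL-FREE input — «the admissible quotient is proper» or «a cusp with pro-`Σ_c` container» — node
# `IUTchI:Cor2.3(iii)` headline, `hcoh`-FREE (row «COR23III-HPRIME-ADMKER-SEQUEL», holder abc-iut-w4-d058)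

Mochizuki, *Inter-universal Teichmüller theory I: construction of Hodge theaters*, kurims manuscript (May 2020), §2,
Cor. 2.3 (iii) p. 47 l. 33–41, proof p. 48 l. 36 – p. 49 l. 32; (iv) p. 47, proof p. 49 l. 33–34; (v) p. 48 l. 1–2, proof
p. 49 l. 38 – p. 50 l. 2 [cite: Mochizuki2012, Cor 2.3 pp.47-50] (D-0012 claim key; series status DISPUTED; the [IUTchI]
items are `[claim: Mochizuki2012, status: disputed]`; PROVED below are the displayed statements about the tree's own objects);
Mochizuki, *Semi-graphs of anabelioids*, Publ. RIMS **42** (2006), Ex. 3.10 pp. 44–45 ("the natural quotient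
`Δ ↠ π₁^temp(𝒢) ≅ π₁^temp(𝒢^c)`"; Cor. 3.11 proof p. 48: coverings with non-trivial inertia at a vertex exist, so the
admissible quotient is proper) [cite: MochizukiSemiAnbd2006, Ex 3.10 pp.44-45]; [AbsAnab] Lemma 1.3.1 p. 15 (the (H′)
centraliser fact, abc-iut-w4-d044's kernel theorem) [cite: MochizukiAbsAnab2004, Lemma 1.3.1 p.15].

PROOF-ONLY one-liners (abc-iut cell; seat abc-iut-w4-d058 gen 9, holder of record of node `IUTchI:Cor2.3(iii)`; the SEQUEL
offered by abc-iut-w4-d052 gen 7 at 03:25Z and taken by this seat): abc-iut-w4-d058's `hcoh`-free (i)–(iv) block on the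
(H′) route `cor23_i_to_iv_ofSpecialFibre_closureH_of_piData_of_mem_decompSubgroups_of_hPrime (hK : ∀ i, N_i ≠ 1)`
(p491060) composed with abc-iut-w4-d052's LEVEL-FREE producers of (y) (p491651):
`inf_ker_ne_bot_towerLevels_ofSpecialFibre_of_admissibleKer_ne_bot (hK : Ker(S.admissible) ≠ 1)` (temp-slimness of
`Δ^tp_X`, open/normal levels DISCHARGED there) and `admissibleKer_ne_bot_ofSpecialFibre_of_cusp` (a cusp `x`, `I_x ≅ Ẑ(1)` a
THEOREM, and a closed pro-`Σ_c` container `W ⊆ Π̂_𝔾` of the image of `I_x`, `p ∉ Σ_c`).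

* `cor23_i_to_iv_ofSpecialFibre_closureH_of_piData_of_mem_decompSubgroups_of_hPrime_of_admissibleKer_ne_bot` — (i)–(iv), NO
  `hcoh`, (y) := «`Ker(S.admissible) ≠ 1`»;
* `cor23iii_ofSpecialFibre_closureH_of_piData_of_mem_decompSubgroups_of_hPrime_of_admissibleKer_ne_bot` — **node
  `IUTchI:Cor2.3(iii)` AS TYPED, THE HEADLINE**; `cor23iv_…_of_admissibleKer_ne_bot` — row (iv) twin;
* `…_of_hPrime_of_cusp` — the same three with (y) := the cuspidal-container input at a curve WITH A CUSP ([IUTchI]'s `X_K`,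
  `X̲_K`, `C_K` are affine with cusps);
* `cor23_i_to_v_ofSpecialFibre_closureH_of_piData_of_mem_decompSubgroups_of_hPrime_of_cusp` — the (i)–(v) headline WITH
  `hcoh` (for (v)'s M. Hall step) that abc-iut-w4-d052 cut from p491651 for the 400-line cap.

BINDER CENSUS of the (iii) headline (classes of L5-lead RULINGS #101 (2) / #108 / #110 (4)): DATA = `X`, `d`, `S`, `Σ`/`Σ̂` +
side conditions, `TpH`, `hTpH`, `cuspMeetsH`, `T`, `P`, (z) `hSig` («`Σ′` unbounded») · DATUM-INTERNAL = `h36`, `S.hyp`,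
the origin datum `hind : P.ActGraphInduces` · FACT-INSTANCE, IN SHAPE = (x) `hΓ`/`hι` («`Δ̂_X` is a pro-`Σ′` completion of a
nonabelian free group», AFFINE hyperbolic curve; GAP-LEDGER G-w4d052-g6-2) · ONE LEVEL-FREE ORIGIN-class input (y) `hK`
(«`Ker(Δ^temp_X ↠ π₁^temp(G^c)) ≠ 1`», [SemiAnbd] Ex. 3.10 / Cor. 3.11 p. 48; TRUE for every geometric `S`, FALSE for an
abstract `S` with injective admissible quotient — hence an input; GAP-LEDGER G-w4d052-g6-3 reduced) — resp., in the `_of_cusp`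
forms, a cusp `x` and `hpS`/`W`/`hWc`/`hW`/`hIW` (print's standing «`𝔾` pro-`Σ`, `p ∉ Σ`» at the cuspidal edge group) · LAW =
none · `hcoh` only in the (i)–(v) headline.  HONEST LIMITS: the (H′) route is NOT print's argument and does not cover finite
`Σ̂` under guard (a) (abc-iut-w4-d052's `…_of_actGraphInduces_of_finite` keeps LAW `{hA}` there); displayed inputs are
hypotheses, not theorems; model-RELATIVE (∀ `X`, `d`, `S`); typed ≠ discharged for the [IUTchI] claim key; no definition,
no instance, no new `Prop` fact; nothing here bears on [IUTchIII] Cor. 3.12 or asserts that abc is proved or refuted.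
-/

noncomputable section

namespace Literature.IUT.HodgeTheaters

open _root_.Topology
open scoped Pointwise
open Literature.AnabelianGeometry.SemiGraphs
open Literature.AnabelianGeometry.SemiGraphs.SemiGraphOfAnabelioids (IsProSigmaCompletion)

namespace StableCurveTemperedData

section Block

variable {p : ℕ} [Fact p.Prime] (X : TemperedCurve p) (d : X.GroupLevelData)
  (S : SpecialFibreData (X.toTemperedArithmeticGroup d)) (h36 : S.Gc.Prop36Hypotheses)
  (Sigma SigmaHat : Set ℕ) (hsub : Sigma ⊆ SigmaHat) (hne : Sigma.Nonempty)
  (hprime : ∀ q ∈ SigmaHat, q.Prime) (hp : p ∉ Sigma)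
  (TpH : Subgroup S.chart.G)
  (cuspMeetsH : {x : X.Pt // X.IsCusp x} → Prop)
  (T : SpecialFibreTower X.DeltaTemp)

/-! ### A. (y) := «the admissible quotient `Δ^temp_X ↠ π₁^temp(G^c)` is proper» -/

/-- **[IUTchI] Cor. 2.3 (i)–(iv) AS TYPED at the genuine datum, `ℍ := P.H`, every `Π^tp_ℍ ∈ decompSubgroups S.chart P.H`,
(H′) route, `hA`/`hB` DISCHARGED, (y) from ONE level-free input `hK : Ker(S.admissible) ≠ 1`, NO `hcoh`**.
[cite: Mochizuki2012, Cor 2.3 pp.47-49] -/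
theorem cor23_i_to_iv_ofSpecialFibre_closureH_of_piData_of_mem_decompSubgroups_of_hPrime_of_admissibleKer_ne_bot
    (P : SpecialFibreTower.PiData X d S T) (hTpH : TpH ∈ S.chart.decompSubgroups P.H)
    (hind : P.ActGraphInduces)
    {Γ : Type*} [Group Γ] [IsFreeGroup Γ] (hΓ : ∃ x y : Γ, x * y ≠ y * x) {Sig : Set ℕ}
    {ι : Γ →* (ofSpecialFibre X d S h36 Sigma SigmaHat hsub hne hprime hp TpH
      ((TpH.map (TemperedGraphGroupData.exists_completion_of_prop36 S.Gc h36
        S.chart).choose_spec.choose.toMonoidHom).topologicalClosure) (Subgroup.le_topologicalClosure _) cuspMeetsH).DeltaHat}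
    (hι : IsProSigmaCompletion Sig ι) (hSig : ∀ m : ℕ, ∃ q ∈ Sig, q.Prime ∧ m < q)
    (hK : S.admissible.toMonoidHom.ker ≠ ⊥) :
    ((ofSpecialFibre X d S h36 Sigma SigmaHat hsub hne hprime hp TpH
      ((TpH.map (TemperedGraphGroupData.exists_completion_of_prop36 S.Gc h36
        S.chart).choose_spec.choose.toMonoidHom).topologicalClosure) (Subgroup.le_topologicalClosure _) cuspMeetsH).Cor23i ∧
      (ofSpecialFibre X d S h36 Sigma SigmaHat hsub hne hprime hp TpH
      ((TpH.map (TemperedGraphGroupData.exists_completion_of_prop36 S.Gc h36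
        S.chart).choose_spec.choose.toMonoidHom).topologicalClosure) (Subgroup.le_topologicalClosure _) cuspMeetsH).Cor23ii ∧
      (ofSpecialFibre X d S h36 Sigma SigmaHat hsub hne hprime hp TpH
      ((TpH.map (TemperedGraphGroupData.exists_completion_of_prop36 S.Gc h36
        S.chart).choose_spec.choose.toMonoidHom).topologicalClosure) (Subgroup.le_topologicalClosure _) cuspMeetsH).Cor23iii ∧
      (ofSpecialFibre X d S h36 Sigma SigmaHat hsub hne hprime hp TpH
      ((TpH.map (TemperedGraphGroupData.exists_completion_of_prop36 S.Gc h36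
        S.chart).choose_spec.choose.toMonoidHom).topologicalClosure) (Subgroup.le_topologicalClosure _) cuspMeetsH).Cor23iv) :=
  cor23_i_to_iv_ofSpecialFibre_closureH_of_piData_of_mem_decompSubgroups_of_hPrime X d S h36 Sigma SigmaHat hsub hne hprime hp TpH cuspMeetsH T P hTpH hind hΓ
    hι hSig
    (inf_ker_ne_bot_towerLevels_ofSpecialFibre_of_admissibleKer_ne_bot X d S h36 Sigma SigmaHat hsub hne hprime hp TpH _ _ cuspMeetsH T hK)

/-- **NODE `IUTchI:Cor2.3(iii)` AS TYPED at the genuine 𝔛-datum — THE HEADLINE** ("`Δ_{X,ℍ}`, `Π_{X,ℍ}` [tempered and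
profinite] are slim; the natural sequences `1 → Δ_{X,ℍ} → Π_{X,ℍ} → G_k → 1` are exact, of center-free groups", under the
typed hypothesis `Cor23Hyp`), `ℍ := P.H`, every `Π^tp_ℍ ∈ decompSubgroups S.chart P.H`, (H′) route at unbounded `Σ′`:
binders = DATA + the origin datum `hind` + (x) `hΓ`/`hι` + ONE level-free input `hK` («the admissible quotient is
proper»); LAW none; NO `hcoh`. [cite: Mochizuki2012, Cor 2.3(iii) pp.47-49] -/
theorem cor23iii_ofSpecialFibre_closureH_of_piData_of_mem_decompSubgroups_of_hPrime_of_admissibleKer_ne_bot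
    (P : SpecialFibreTower.PiData X d S T) (hTpH : TpH ∈ S.chart.decompSubgroups P.H)
    (hind : P.ActGraphInduces)
    {Γ : Type*} [Group Γ] [IsFreeGroup Γ] (hΓ : ∃ x y : Γ, x * y ≠ y * x) {Sig : Set ℕ}
    {ι : Γ →* (ofSpecialFibre X d S h36 Sigma SigmaHat hsub hne hprime hp TpH
      ((TpH.map (TemperedGraphGroupData.exists_completion_of_prop36 S.Gc h36
        S.chart).choose_spec.choose.toMonoidHom).topologicalClosure) (Subgroup.le_topologicalClosure _) cuspMeetsH).DeltaHat}
    (hι : IsProSigmaCompletion Sig ι) (hSig : ∀ m : ℕ, ∃ q ∈ Sig, q.Prime ∧ m < q)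
    (hK : S.admissible.toMonoidHom.ker ≠ ⊥) :
    (ofSpecialFibre X d S h36 Sigma SigmaHat hsub hne hprime hp TpH
      ((TpH.map (TemperedGraphGroupData.exists_completion_of_prop36 S.Gc h36
        S.chart).choose_spec.choose.toMonoidHom).topologicalClosure) (Subgroup.le_topologicalClosure _) cuspMeetsH).Cor23iii :=
  (cor23_i_to_iv_ofSpecialFibre_closureH_of_piData_of_mem_decompSubgroups_of_hPrime_of_admissibleKer_ne_bot X d S h36 Sigma SigmaHat hsub hne hprime hp TpH
    cuspMeetsH T P hTpH hind hΓ hι hSig hK).2.2.1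

/-- **Row `IUTchI:Cor2.3(iv)` AS TYPED at the genuine datum, (H′) route, (y) := `hK : Ker(S.admissible) ≠ 1`, NO `hcoh`.**
[cite: Mochizuki2012, Cor 2.3(iv) p.49] -/
theorem cor23iv_ofSpecialFibre_closureH_of_piData_of_mem_decompSubgroups_of_hPrime_of_admissibleKer_ne_bot
    (P : SpecialFibreTower.PiData X d S T) (hTpH : TpH ∈ S.chart.decompSubgroups P.H)
    (hind : P.ActGraphInduces)
    {Γ : Type*} [Group Γ] [IsFreeGroup Γ] (hΓ : ∃ x y : Γ, x * y ≠ y * x) {Sig : Set ℕ}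
    {ι : Γ →* (ofSpecialFibre X d S h36 Sigma SigmaHat hsub hne hprime hp TpH
      ((TpH.map (TemperedGraphGroupData.exists_completion_of_prop36 S.Gc h36
        S.chart).choose_spec.choose.toMonoidHom).topologicalClosure) (Subgroup.le_topologicalClosure _) cuspMeetsH).DeltaHat}
    (hι : IsProSigmaCompletion Sig ι) (hSig : ∀ m : ℕ, ∃ q ∈ Sig, q.Prime ∧ m < q)
    (hK : S.admissible.toMonoidHom.ker ≠ ⊥) :
    (ofSpecialFibre X d S h36 Sigma SigmaHat hsub hne hprime hp TpH
      ((TpH.map (TemperedGraphGroupData.exists_completion_of_prop36 S.Gc h36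
        S.chart).choose_spec.choose.toMonoidHom).topologicalClosure) (Subgroup.le_topologicalClosure _) cuspMeetsH).Cor23iv :=
  (cor23_i_to_iv_ofSpecialFibre_closureH_of_piData_of_mem_decompSubgroups_of_hPrime_of_admissibleKer_ne_bot X d S h36 Sigma SigmaHat hsub hne hprime hp TpH
    cuspMeetsH T P hTpH hind hΓ hι hSig hK).2.2.2

/-! ### B. (y) := a cusp whose inertia image has a closed pro-`Σ_c` container in `Π̂_𝔾`, `p ∉ Σ_c` -/

/-- **[IUTchI] Cor. 2.3 (i)–(iv) AS TYPED at the genuine datum, (H′) route, (y) from a CUSP `x`** (`I_x ≅ Ẑ(1)` is a THEOREM at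
the datum; displayed: a closed pro-`Σ_c` subgroup `W ⊆ Π̂_𝔾`, `p ∉ Σ_c`, containing the image of `I_x` — print's standing
«`𝔾` pro-`Σ`, `p ∉ Σ`» at the cuspidal edge group), NO `hcoh`. [cite: Mochizuki2012, Cor 2.3 pp.47-49] -/
theorem cor23_i_to_iv_ofSpecialFibre_closureH_of_piData_of_mem_decompSubgroups_of_hPrime_of_cusp
    (P : SpecialFibreTower.PiData X d S T) (hTpH : TpH ∈ S.chart.decompSubgroups P.H)
    (hind : P.ActGraphInduces)
    {Γ : Type*} [Group Γ] [IsFreeGroup Γ] (hΓ : ∃ x y : Γ, x * y ≠ y * x) {Sig : Set ℕ}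
    {ι : Γ →* (ofSpecialFibre X d S h36 Sigma SigmaHat hsub hne hprime hp TpH
      ((TpH.map (TemperedGraphGroupData.exists_completion_of_prop36 S.Gc h36
        S.chart).choose_spec.choose.toMonoidHom).topologicalClosure) (Subgroup.le_topologicalClosure _) cuspMeetsH).DeltaHat}
    (hι : IsProSigmaCompletion Sig ι) (hSig : ∀ m : ℕ, ∃ q ∈ Sig, q.Prime ∧ m < q)
    (x : {x : X.Pt // X.IsCusp x}) {Sc : Set ℕ} (hpS : p ∉ Sc)
    (W : Subgroup (ofSpecialFibre X d S h36 Sigma SigmaHat hsub hne hprime hp TpH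
      ((TpH.map (TemperedGraphGroupData.exists_completion_of_prop36 S.Gc h36
        S.chart).choose_spec.choose.toMonoidHom).topologicalClosure) (Subgroup.le_topologicalClosure _) cuspMeetsH).graph.Hat)
    (hWc : IsClosed (W : Set (ofSpecialFibre X d S h36 Sigma SigmaHat hsub hne hprime hp TpH
      ((TpH.map (TemperedGraphGroupData.exists_completion_of_prop36 S.Gc h36
        S.chart).choose_spec.choose.toMonoidHom).topologicalClosure) (Subgroup.le_topologicalClosure _) cuspMeetsH).graph.Hat))
    (hW : IsProSigma Sc W)
    (hIW : (((ofSpecialFibre X d S h36 Sigma SigmaHat hsub hne hprime hp TpH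
      ((TpH.map (TemperedGraphGroupData.exists_completion_of_prop36 S.Gc h36
        S.chart).choose_spec.choose.toMonoidHom).topologicalClosure) (Subgroup.le_topologicalClosure _) cuspMeetsH).inertiaTp x).map
        (ofSpecialFibre X d S h36 Sigma SigmaHat hsub hne hprime hp TpH
      ((TpH.map (TemperedGraphGroupData.exists_completion_of_prop36 S.Gc h36
        S.chart).choose_spec.choose.toMonoidHom).topologicalClosure) (Subgroup.le_topologicalClosure _) cuspMeetsH).ρTp).map
        (ofSpecialFibre X d S h36 Sigma SigmaHat hsub hne hprime hp TpH
      ((TpH.map (TemperedGraphGroupData.exists_completion_of_prop36 S.Gc h36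
        S.chart).choose_spec.choose.toMonoidHom).topologicalClosure) (Subgroup.le_topologicalClosure _) cuspMeetsH).graph.ι ≤ W) :
    ((ofSpecialFibre X d S h36 Sigma SigmaHat hsub hne hprime hp TpH
      ((TpH.map (TemperedGraphGroupData.exists_completion_of_prop36 S.Gc h36
        S.chart).choose_spec.choose.toMonoidHom).topologicalClosure) (Subgroup.le_topologicalClosure _) cuspMeetsH).Cor23i ∧
      (ofSpecialFibre X d S h36 Sigma SigmaHat hsub hne hprime hp TpH
      ((TpH.map (TemperedGraphGroupData.exists_completion_of_prop36 S.Gc h36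
        S.chart).choose_spec.choose.toMonoidHom).topologicalClosure) (Subgroup.le_topologicalClosure _) cuspMeetsH).Cor23ii ∧
      (ofSpecialFibre X d S h36 Sigma SigmaHat hsub hne hprime hp TpH
      ((TpH.map (TemperedGraphGroupData.exists_completion_of_prop36 S.Gc h36
        S.chart).choose_spec.choose.toMonoidHom).topologicalClosure) (Subgroup.le_topologicalClosure _) cuspMeetsH).Cor23iii ∧
      (ofSpecialFibre X d S h36 Sigma SigmaHat hsub hne hprime hp TpH
      ((TpH.map (TemperedGraphGroupData.exists_completion_of_prop36 S.Gc h36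
        S.chart).choose_spec.choose.toMonoidHom).topologicalClosure) (Subgroup.le_topologicalClosure _) cuspMeetsH).Cor23iv) :=
  cor23_i_to_iv_ofSpecialFibre_closureH_of_piData_of_mem_decompSubgroups_of_hPrime_of_admissibleKer_ne_bot X d S h36 Sigma SigmaHat hsub hne hprime hp TpH
    cuspMeetsH T P hTpH hind hΓ hι hSig
    (admissibleKer_ne_bot_ofSpecialFibre_of_cusp X d S h36 Sigma SigmaHat hsub hne hprime hp TpH _ _ cuspMeetsH x hpS W hWc hW hIW)

/-- **NODE `IUTchI:Cor2.3(iii)` AS TYPED at the genuine datum of a curve WITH A CUSP, (H′) route** — binders = DATA + `hind`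
+ (x) + the cuspidal-container input {`x`, `hpS`, `W`, `hWc`, `hW`, `hIW`}; LAW none; NO `hcoh`.
[cite: Mochizuki2012, Cor 2.3(iii) pp.47-49] -/
theorem cor23iii_ofSpecialFibre_closureH_of_piData_of_mem_decompSubgroups_of_hPrime_of_cusp
    (P : SpecialFibreTower.PiData X d S T) (hTpH : TpH ∈ S.chart.decompSubgroups P.H)
    (hind : P.ActGraphInduces)
    {Γ : Type*} [Group Γ] [IsFreeGroup Γ] (hΓ : ∃ x y : Γ, x * y ≠ y * x) {Sig : Set ℕ}
    {ι : Γ →* (ofSpecialFibre X d S h36 Sigma SigmaHat hsub hne hprime hp TpH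
      ((TpH.map (TemperedGraphGroupData.exists_completion_of_prop36 S.Gc h36
        S.chart).choose_spec.choose.toMonoidHom).topologicalClosure) (Subgroup.le_topologicalClosure _) cuspMeetsH).DeltaHat}
    (hι : IsProSigmaCompletion Sig ι) (hSig : ∀ m : ℕ, ∃ q ∈ Sig, q.Prime ∧ m < q)
    (x : {x : X.Pt // X.IsCusp x}) {Sc : Set ℕ} (hpS : p ∉ Sc)
    (W : Subgroup (ofSpecialFibre X d S h36 Sigma SigmaHat hsub hne hprime hp TpH
      ((TpH.map (TemperedGraphGroupData.exists_completion_of_prop36 S.Gc h36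
        S.chart).choose_spec.choose.toMonoidHom).topologicalClosure) (Subgroup.le_topologicalClosure _) cuspMeetsH).graph.Hat)
    (hWc : IsClosed (W : Set (ofSpecialFibre X d S h36 Sigma SigmaHat hsub hne hprime hp TpH
      ((TpH.map (TemperedGraphGroupData.exists_completion_of_prop36 S.Gc h36
        S.chart).choose_spec.choose.toMonoidHom).topologicalClosure) (Subgroup.le_topologicalClosure _) cuspMeetsH).graph.Hat))
    (hW : IsProSigma Sc W)
    (hIW : (((ofSpecialFibre X d S h36 Sigma SigmaHat hsub hne hprime hp TpH
      ((TpH.map (TemperedGraphGroupData.exists_completion_of_prop36 S.Gc h36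
        S.chart).choose_spec.choose.toMonoidHom).topologicalClosure) (Subgroup.le_topologicalClosure _) cuspMeetsH).inertiaTp x).map
        (ofSpecialFibre X d S h36 Sigma SigmaHat hsub hne hprime hp TpH
      ((TpH.map (TemperedGraphGroupData.exists_completion_of_prop36 S.Gc h36
        S.chart).choose_spec.choose.toMonoidHom).topologicalClosure) (Subgroup.le_topologicalClosure _) cuspMeetsH).ρTp).map
        (ofSpecialFibre X d S h36 Sigma SigmaHat hsub hne hprime hp TpH
      ((TpH.map (TemperedGraphGroupData.exists_completion_of_prop36 S.Gc h36
        S.chart).choose_spec.choose.toMonoidHom).topologicalClosure) (Subgroup.le_topologicalClosure _) cuspMeetsH).graph.ι ≤ W) :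
    (ofSpecialFibre X d S h36 Sigma SigmaHat hsub hne hprime hp TpH
      ((TpH.map (TemperedGraphGroupData.exists_completion_of_prop36 S.Gc h36
        S.chart).choose_spec.choose.toMonoidHom).topologicalClosure) (Subgroup.le_topologicalClosure _) cuspMeetsH).Cor23iii :=
  (cor23_i_to_iv_ofSpecialFibre_closureH_of_piData_of_mem_decompSubgroups_of_hPrime_of_cusp X d S h36 Sigma SigmaHat hsub hne hprime hp TpH cuspMeetsH T P hTpH
    hind hΓ hι hSig x hpS W hWc hW hIW).2.2.1

/-- **Row `IUTchI:Cor2.3(iv)` AS TYPED at the genuine datum of a curve WITH A CUSP, (H′) route, NO `hcoh`.**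
[cite: Mochizuki2012, Cor 2.3(iv) p.49] -/
theorem cor23iv_ofSpecialFibre_closureH_of_piData_of_mem_decompSubgroups_of_hPrime_of_cusp
    (P : SpecialFibreTower.PiData X d S T) (hTpH : TpH ∈ S.chart.decompSubgroups P.H)
    (hind : P.ActGraphInduces)
    {Γ : Type*} [Group Γ] [IsFreeGroup Γ] (hΓ : ∃ x y : Γ, x * y ≠ y * x) {Sig : Set ℕ}
    {ι : Γ →* (ofSpecialFibre X d S h36 Sigma SigmaHat hsub hne hprime hp TpH
      ((TpH.map (TemperedGraphGroupData.exists_completion_of_prop36 S.Gc h36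
        S.chart).choose_spec.choose.toMonoidHom).topologicalClosure) (Subgroup.le_topologicalClosure _) cuspMeetsH).DeltaHat}
    (hι : IsProSigmaCompletion Sig ι) (hSig : ∀ m : ℕ, ∃ q ∈ Sig, q.Prime ∧ m < q)
    (x : {x : X.Pt // X.IsCusp x}) {Sc : Set ℕ} (hpS : p ∉ Sc)
    (W : Subgroup (ofSpecialFibre X d S h36 Sigma SigmaHat hsub hne hprime hp TpH
      ((TpH.map (TemperedGraphGroupData.exists_completion_of_prop36 S.Gc h36
        S.chart).choose_spec.choose.toMonoidHom).topologicalClosure) (Subgroup.le_topologicalClosure _) cuspMeetsH).graph.Hat)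
    (hWc : IsClosed (W : Set (ofSpecialFibre X d S h36 Sigma SigmaHat hsub hne hprime hp TpH
      ((TpH.map (TemperedGraphGroupData.exists_completion_of_prop36 S.Gc h36
        S.chart).choose_spec.choose.toMonoidHom).topologicalClosure) (Subgroup.le_topologicalClosure _) cuspMeetsH).graph.Hat))
    (hW : IsProSigma Sc W)
    (hIW : (((ofSpecialFibre X d S h36 Sigma SigmaHat hsub hne hprime hp TpH
      ((TpH.map (TemperedGraphGroupData.exists_completion_of_prop36 S.Gc h36
        S.chart).choose_spec.choose.toMonoidHom).topologicalClosure) (Subgroup.le_topologicalClosure _) cuspMeetsH).inertiaTp x).map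
        (ofSpecialFibre X d S h36 Sigma SigmaHat hsub hne hprime hp TpH
      ((TpH.map (TemperedGraphGroupData.exists_completion_of_prop36 S.Gc h36
        S.chart).choose_spec.choose.toMonoidHom).topologicalClosure) (Subgroup.le_topologicalClosure _) cuspMeetsH).ρTp).map
        (ofSpecialFibre X d S h36 Sigma SigmaHat hsub hne hprime hp TpH
      ((TpH.map (TemperedGraphGroupData.exists_completion_of_prop36 S.Gc h36
        S.chart).choose_spec.choose.toMonoidHom).topologicalClosure) (Subgroup.le_topologicalClosure _) cuspMeetsH).graph.ι ≤ W) :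
    (ofSpecialFibre X d S h36 Sigma SigmaHat hsub hne hprime hp TpH
      ((TpH.map (TemperedGraphGroupData.exists_completion_of_prop36 S.Gc h36
        S.chart).choose_spec.choose.toMonoidHom).topologicalClosure) (Subgroup.le_topologicalClosure _) cuspMeetsH).Cor23iv :=
  (cor23_i_to_iv_ofSpecialFibre_closureH_of_piData_of_mem_decompSubgroups_of_hPrime_of_cusp X d S h36 Sigma SigmaHat hsub hne hprime hp TpH cuspMeetsH T P hTpH
    hind hΓ hι hSig x hpS W hWc hW hIW).2.2.2

/-! ### C. The (i)–(v) headline from a cusp (with `hcoh`, used by (v) only) -/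

/-- **[IUTchI] Cor. 2.3 (i)–(v) AS TYPED at the genuine datum of a curve WITH A CUSP, `ℍ := P.H`, every
`Π^tp_ℍ ∈ decompSubgroups S.chart P.H`, (H′) route** — abc-iut-w4-d052's
`…_of_hPrime_of_admissibleKer_ne_bot` (p491651) with `hK :=` its `admissibleKer_ne_bot_ofSpecialFibre_of_cusp`; binders =
DATA + `hind` + `hcoh` ((v) only) + (x) + the cuspidal-container input; LAW none. [cite: Mochizuki2012, Cor 2.3 pp.47-50] -/
theorem cor23_i_to_v_ofSpecialFibre_closureH_of_piData_of_mem_decompSubgroups_of_hPrime_of_cusp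
    (P : SpecialFibreTower.PiData X d S T) (hcoh : S.Gc.IsCoherent) (hTpH : TpH ∈ S.chart.decompSubgroups P.H)
    (hind : P.ActGraphInduces)
    {Γ : Type*} [Group Γ] [IsFreeGroup Γ] (hΓ : ∃ x y : Γ, x * y ≠ y * x) {Sig : Set ℕ}
    {ι : Γ →* (ofSpecialFibre X d S h36 Sigma SigmaHat hsub hne hprime hp TpH
      ((TpH.map (TemperedGraphGroupData.exists_completion_of_prop36 S.Gc h36
        S.chart).choose_spec.choose.toMonoidHom).topologicalClosure) (Subgroup.le_topologicalClosure _) cuspMeetsH).DeltaHat}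
    (hι : IsProSigmaCompletion Sig ι) (hSig : ∀ m : ℕ, ∃ q ∈ Sig, q.Prime ∧ m < q)
    (x : {x : X.Pt // X.IsCusp x}) {Sc : Set ℕ} (hpS : p ∉ Sc)
    (W : Subgroup (ofSpecialFibre X d S h36 Sigma SigmaHat hsub hne hprime hp TpH
      ((TpH.map (TemperedGraphGroupData.exists_completion_of_prop36 S.Gc h36
        S.chart).choose_spec.choose.toMonoidHom).topologicalClosure) (Subgroup.le_topologicalClosure _) cuspMeetsH).graph.Hat)
    (hWc : IsClosed (W : Set (ofSpecialFibre X d S h36 Sigma SigmaHat hsub hne hprime hp TpH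
      ((TpH.map (TemperedGraphGroupData.exists_completion_of_prop36 S.Gc h36
        S.chart).choose_spec.choose.toMonoidHom).topologicalClosure) (Subgroup.le_topologicalClosure _) cuspMeetsH).graph.Hat))
    (hW : IsProSigma Sc W)
    (hIW : (((ofSpecialFibre X d S h36 Sigma SigmaHat hsub hne hprime hp TpH
      ((TpH.map (TemperedGraphGroupData.exists_completion_of_prop36 S.Gc h36
        S.chart).choose_spec.choose.toMonoidHom).topologicalClosure) (Subgroup.le_topologicalClosure _) cuspMeetsH).inertiaTp x).map
        (ofSpecialFibre X d S h36 Sigma SigmaHat hsub hne hprime hp TpH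
      ((TpH.map (TemperedGraphGroupData.exists_completion_of_prop36 S.Gc h36
        S.chart).choose_spec.choose.toMonoidHom).topologicalClosure) (Subgroup.le_topologicalClosure _) cuspMeetsH).ρTp).map
        (ofSpecialFibre X d S h36 Sigma SigmaHat hsub hne hprime hp TpH
      ((TpH.map (TemperedGraphGroupData.exists_completion_of_prop36 S.Gc h36
        S.chart).choose_spec.choose.toMonoidHom).topologicalClosure) (Subgroup.le_topologicalClosure _) cuspMeetsH).graph.ι ≤ W) :
    ((ofSpecialFibre X d S h36 Sigma SigmaHat hsub hne hprime hp TpH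
      ((TpH.map (TemperedGraphGroupData.exists_completion_of_prop36 S.Gc h36
        S.chart).choose_spec.choose.toMonoidHom).topologicalClosure) (Subgroup.le_topologicalClosure _) cuspMeetsH).Cor23i ∧
      (ofSpecialFibre X d S h36 Sigma SigmaHat hsub hne hprime hp TpH
      ((TpH.map (TemperedGraphGroupData.exists_completion_of_prop36 S.Gc h36
        S.chart).choose_spec.choose.toMonoidHom).topologicalClosure) (Subgroup.le_topologicalClosure _) cuspMeetsH).Cor23ii ∧
      (ofSpecialFibre X d S h36 Sigma SigmaHat hsub hne hprime hp TpH
      ((TpH.map (TemperedGraphGroupData.exists_completion_of_prop36 S.Gc h36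
        S.chart).choose_spec.choose.toMonoidHom).topologicalClosure) (Subgroup.le_topologicalClosure _) cuspMeetsH).Cor23iii ∧
      (ofSpecialFibre X d S h36 Sigma SigmaHat hsub hne hprime hp TpH
      ((TpH.map (TemperedGraphGroupData.exists_completion_of_prop36 S.Gc h36
        S.chart).choose_spec.choose.toMonoidHom).topologicalClosure) (Subgroup.le_topologicalClosure _) cuspMeetsH).Cor23iv) ∧
      (ofSpecialFibre X d S h36 Sigma SigmaHat hsub hne hprime hp TpH
      ((TpH.map (TemperedGraphGroupData.exists_completion_of_prop36 S.Gc h36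
        S.chart).choose_spec.choose.toMonoidHom).topologicalClosure) (Subgroup.le_topologicalClosure _) cuspMeetsH).Cor23v :=
  cor23_i_to_v_ofSpecialFibre_closureH_of_piData_of_mem_decompSubgroups_of_hPrime_of_admissibleKer_ne_bot X d S h36 Sigma SigmaHat hsub hne hprime hp TpH
    cuspMeetsH T P hcoh hTpH hind hΓ hι hSig
    (admissibleKer_ne_bot_ofSpecialFibre_of_cusp X d S h36 Sigma SigmaHat hsub hne hprime hp TpH _ _ cuspMeetsH x hpS W hWc hW hIW)

/-! ### D. (z) GONE: `Σ′ :=` all primes — (x) reads «`Δ̂_X` is the PROFINITE completion of a nonabelian free group»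

Appended (v2, abc-iut-w4-d058 gen 9, on abc-iut-w4-d052 gen 7's census observation 03:40Z): at the genuine datum
`Δ̂_X = X.DeltaHat` is the FULL profinite completion of `Δ^temp_X` for EVERY value of the labels `Σ ⊆ Σ̂`
(`ofSpecialFibre_deltaHat`), so the natural (x) is `IsProSigmaCompletion {q | q.Prime} ι` (Riemann existence / [SGA1 XIII]
at an AFFINE hyperbolic curve), for which (z) «`Σ′` unbounded» is Euclid's theorem (`Nat.exists_infinite_primes`). -/

/-- Euclid, in the shape of the (z) binder: the set of all primes is unbounded (private helper). [folklore] -/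
private theorem primes_unbounded_hSig : ∀ m : ℕ, ∃ q ∈ {q : ℕ | q.Prime}, q.Prime ∧ m < q := fun m =>
  let ⟨q, hmq, hq⟩ := Nat.exists_infinite_primes (m + 1)
  ⟨q, hq, hq, hmq⟩

/-- **[IUTchI] Cor. 2.3 (i)–(iv) AS TYPED at the genuine datum, (H′) route at `Σ′ :=` ALL PRIMES** — (z) GONE (Euclid);
binders = DATA + `hind` + (x) «`Δ̂_X` is the profinite completion of a nonabelian free group» + ONE level-free input `hK`;
NO `hcoh`; valid for ALL labels `Σ ⊆ Σ̂` of the bridge. [cite: Mochizuki2012, Cor 2.3 pp.47-49] -/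
theorem cor23_i_to_iv_ofSpecialFibre_closureH_of_piData_of_mem_decompSubgroups_of_hPrime_of_admissibleKer_ne_bot_primes
    (P : SpecialFibreTower.PiData X d S T) (hTpH : TpH ∈ S.chart.decompSubgroups P.H)
    (hind : P.ActGraphInduces)
    {Γ : Type*} [Group Γ] [IsFreeGroup Γ] (hΓ : ∃ x y : Γ, x * y ≠ y * x)
    {ι : Γ →* (ofSpecialFibre X d S h36 Sigma SigmaHat hsub hne hprime hp TpH
      ((TpH.map (TemperedGraphGroupData.exists_completion_of_prop36 S.Gc h36
        S.chart).choose_spec.choose.toMonoidHom).topologicalClosure) (Subgroup.le_topologicalClosure _) cuspMeetsH).DeltaHat}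
    (hι : IsProSigmaCompletion {q : ℕ | q.Prime} ι)
    (hK : S.admissible.toMonoidHom.ker ≠ ⊥) :
    ((ofSpecialFibre X d S h36 Sigma SigmaHat hsub hne hprime hp TpH
      ((TpH.map (TemperedGraphGroupData.exists_completion_of_prop36 S.Gc h36
        S.chart).choose_spec.choose.toMonoidHom).topologicalClosure) (Subgroup.le_topologicalClosure _) cuspMeetsH).Cor23i ∧
      (ofSpecialFibre X d S h36 Sigma SigmaHat hsub hne hprime hp TpH
      ((TpH.map (TemperedGraphGroupData.exists_completion_of_prop36 S.Gc h36
        S.chart).choose_spec.choose.toMonoidHom).topologicalClosure) (Subgroup.le_topologicalClosure _) cuspMeetsH).Cor23ii ∧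
      (ofSpecialFibre X d S h36 Sigma SigmaHat hsub hne hprime hp TpH
      ((TpH.map (TemperedGraphGroupData.exists_completion_of_prop36 S.Gc h36
        S.chart).choose_spec.choose.toMonoidHom).topologicalClosure) (Subgroup.le_topologicalClosure _) cuspMeetsH).Cor23iii ∧
      (ofSpecialFibre X d S h36 Sigma SigmaHat hsub hne hprime hp TpH
      ((TpH.map (TemperedGraphGroupData.exists_completion_of_prop36 S.Gc h36
        S.chart).choose_spec.choose.toMonoidHom).topologicalClosure) (Subgroup.le_topologicalClosure _) cuspMeetsH).Cor23iv) :=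
  cor23_i_to_iv_ofSpecialFibre_closureH_of_piData_of_mem_decompSubgroups_of_hPrime_of_admissibleKer_ne_bot X d S h36 Sigma SigmaHat hsub hne hprime hp TpH
    cuspMeetsH T P hTpH hind hΓ hι primes_unbounded_hSig hK

/-- **NODE `IUTchI:Cor2.3(iii)` AS TYPED at the genuine 𝔛-datum, (H′) route at `Σ′ :=` ALL PRIMES — (z) GONE**: binders =
DATA + the origin datum `hind` + (x) «`Δ̂_X` is the PROFINITE completion of a nonabelian free group» (GAP-LEDGER
G-w4d052-g6-2, the form true at an affine hyperbolic curve) + ONE level-free origin-class input `hK` («the admissible quotient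
is proper»); LAW none; NO `hcoh`; for ALL labels `Σ ⊆ Σ̂`. [cite: Mochizuki2012, Cor 2.3(iii) pp.47-49] -/
theorem cor23iii_ofSpecialFibre_closureH_of_piData_of_mem_decompSubgroups_of_hPrime_of_admissibleKer_ne_bot_primes
    (P : SpecialFibreTower.PiData X d S T) (hTpH : TpH ∈ S.chart.decompSubgroups P.H)
    (hind : P.ActGraphInduces)
    {Γ : Type*} [Group Γ] [IsFreeGroup Γ] (hΓ : ∃ x y : Γ, x * y ≠ y * x)
    {ι : Γ →* (ofSpecialFibre X d S h36 Sigma SigmaHat hsub hne hprime hp TpH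
      ((TpH.map (TemperedGraphGroupData.exists_completion_of_prop36 S.Gc h36
        S.chart).choose_spec.choose.toMonoidHom).topologicalClosure) (Subgroup.le_topologicalClosure _) cuspMeetsH).DeltaHat}
    (hι : IsProSigmaCompletion {q : ℕ | q.Prime} ι)
    (hK : S.admissible.toMonoidHom.ker ≠ ⊥) :
    (ofSpecialFibre X d S h36 Sigma SigmaHat hsub hne hprime hp TpH
      ((TpH.map (TemperedGraphGroupData.exists_completion_of_prop36 S.Gc h36
        S.chart).choose_spec.choose.toMonoidHom).topologicalClosure) (Subgroup.le_topologicalClosure _) cuspMeetsH).Cor23iii :=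
  (cor23_i_to_iv_ofSpecialFibre_closureH_of_piData_of_mem_decompSubgroups_of_hPrime_of_admissibleKer_ne_bot_primes X d S h36 Sigma SigmaHat hsub hne hprime hp TpH
    cuspMeetsH T P hTpH hind hΓ hι hK).2.2.1

/-- **Row `IUTchI:Cor2.3(iv)` AS TYPED at the genuine datum, (H′) route at `Σ′ :=` ALL PRIMES — (z) GONE**, NO `hcoh`.
[cite: Mochizuki2012, Cor 2.3(iv) p.49] -/
theorem cor23iv_ofSpecialFibre_closureH_of_piData_of_mem_decompSubgroups_of_hPrime_of_admissibleKer_ne_bot_primes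
    (P : SpecialFibreTower.PiData X d S T) (hTpH : TpH ∈ S.chart.decompSubgroups P.H)
    (hind : P.ActGraphInduces)
    {Γ : Type*} [Group Γ] [IsFreeGroup Γ] (hΓ : ∃ x y : Γ, x * y ≠ y * x)
    {ι : Γ →* (ofSpecialFibre X d S h36 Sigma SigmaHat hsub hne hprime hp TpH
      ((TpH.map (TemperedGraphGroupData.exists_completion_of_prop36 S.Gc h36
        S.chart).choose_spec.choose.toMonoidHom).topologicalClosure) (Subgroup.le_topologicalClosure _) cuspMeetsH).DeltaHat}
    (hι : IsProSigmaCompletion {q : ℕ | q.Prime} ι)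
    (hK : S.admissible.toMonoidHom.ker ≠ ⊥) :
    (ofSpecialFibre X d S h36 Sigma SigmaHat hsub hne hprime hp TpH
      ((TpH.map (TemperedGraphGroupData.exists_completion_of_prop36 S.Gc h36
        S.chart).choose_spec.choose.toMonoidHom).topologicalClosure) (Subgroup.le_topologicalClosure _) cuspMeetsH).Cor23iv :=
  (cor23_i_to_iv_ofSpecialFibre_closureH_of_piData_of_mem_decompSubgroups_of_hPrime_of_admissibleKer_ne_bot_primes X d S h36 Sigma SigmaHat hsub hne hprime hp TpH
    cuspMeetsH T P hTpH hind hΓ hι hK).2.2.2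

end Block

end StableCurveTemperedData

end Literature.IUT.HodgeTheaters

end
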